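import Literature.NumberTheory.GelbartRogawski1991.ThetaTypeNonsplitJacquetModule          -- ★ N3 letter (typ-T7a p826177) + vocabulary (`xThetaGqsCM`, `IsThetaCenterChar`, …)
import Summits.HodgeConjecture.HodgeConjecture.Theorems.F0P2nXThetaCentralCharacter         -- ★ K0 (B-p18 (g27) p825910): `xThetaCM_localCenter`
import Summits.HodgeConjecture.HodgeConjecture.Theorems.F0P2oK1wOfWeylConj                  -- ★ p826576 (F0P2-p02 (g5)): `unitModulusChar_units_map_of_involutive`
import HarnessLib

/-!
# Crux `H413`, programme P2, N3 road — THE (b)-ASSEMBLER AND THE N3 PACKAGER: clause (b) of the print letter ★ N3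
# `GelbartRogawski1991.thetaType_nonsplit_jacquetModule` («the torus acts on `r_N(X_v)` by `χθ = μ_v‖·‖^{1/2} ⊗ ψθ`») FROM the `m(γ)`-weight
# alone — NO (S5) dictionary — and the letter packaged from {clause (a), the `m(γ)`-weight}

Cell hodgecm-mathlib (D-0151), FLOOR 0, crux item H413 = stmt-HodgeConjecture-24833, programme P2; K1 sub-line `Cruxes/H413/Lines/F0_P2GR91NJacquetK1.lean`
(v3c; only residue = the print letter N3 #96); N3 road of the K1 lead B-p18 (g28) (`F0/P2/B-p18/g28/N3-ROAD.v2.B-p18g28.md` 431ec2a705fc6088 §2–§3; lead «=»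
2026-08-31T20:54:00Z).  Seat F0P2-p06 (g3).  THEOREMS ONLY (no `def`, no instance, no notation, no named fact, no `sorry`); no `Cruxes/…/Lines` import; kernel
lane `--supports stmt-HodgeConjecture-24833 --as helper`.  HC_CM is proved only modulo the 2 remaining named inputs (hLiu418, h413) — behind them the booked printed
statements + the MOD package — until rung 0 closes; this file proves no letter: it REDUCES clause (b) of N3 to the `m(γ)`-weight (brick (D3d)) and packages N3.

THE MATHEMATICS [GelbartRogawski1991 §3.2 (3.2.1)–(3.2.2) p. 457; Kudla1986 Thm. 2.8].  On the (unnormalised) Jacquet module `r_N(X_v)` of Liu's local theta type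
read on `U(Φ₃)(L⁺_v)` (★ `xThetaGqsCM`) the diagonal torus acts by `χθ(d(α, β, ᾱ⁻¹)) = μ_v(α)‖α‖^{1/2}ψθ(β)` (★ `cmXiTorusChar L v μ_v ψθ⁻¹ ψθ`).  The road's
brick (D3d) (A-p16 (g24)) gives the weight `μ_v(γ)‖γ‖^{1/2}` of `m(γ) = d(γ, 1, γ̄⁻¹)` for EVERY `γ ∈ E_w^×`; the rest of (b) needs no line-model dictionary:
`d(α, β, ᾱ⁻¹) = z(β)·m(α/β)` with `z(β) = β·1₃` CENTRAL (`ββ̄ = 1`); `z(β)` acts on `X_v` by `χ_{f,v}(β)` — the form congruence fixes scalars and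
`localPiEquiv⁻¹(β·1₃) = localCenter (β)` (§2), then ★ K0 `F0P2nXThetaCentralCharacter.xThetaCM_localCenter` (p825910); `‖β‖ = 1` on `E¹_v` (§2, from ★
`F0P2oK1wOfWeylConj.unitModulusChar_units_map_of_involutive`); `χ_{f,v}(β)μ_v(β)⁻¹ = ψθ(β)` is ★ `IsThetaCenterChar` at the `1 × 1` matrix `(β)`; and
`χ_{f,v}(β)·μ_v(α/β)‖α/β‖^{1/2} = cmXiTorusChar … (d(α, β, ᾱ⁻¹))` by ★ `xiTorusChar_apply` (`ψθ⁻¹(α/ᾱ)·ψθ(αβᾱ⁻¹) = ψθ(β)`).  §1 is the generic descent the (D3d)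
interface uses: a scalar modulo the `N`-relations of the Weil representation descends through the `χ_{f,v}`-coinvariants (★ `TwistedCoinv.rep`) to `r_N`.

HEADS.  §1 `jacquetModule_eq_smul_of_forall_sub_smul_mem` (+ `'`, `_of_eq_smul_one`), `coinvariantsKer_restrict_eq`, `jacquetModule_twistedCoinv_comp_eq_smul`;
§2 `glDiagonal_one_mem_local`, `localDet_glDiagonal_one`, `localPiEquiv_symm_cmDatumLocalCongr_scalar`, `halfModulusChar_eq_one_of_norm_one`; §3 `jacquetModule_xThetaGqsCM_scalar`,
**`thetaType_nonsplit_jacquetModule_b_of_torusWeight`** (clause (b) VERBATIM from `hD`: every `t ∈ T(L⁺_v)` with `t₁₁ = 1` acts on `r_N(X_v)` by `μ_v(t₀₀)‖t₀₀‖^{1/2}`,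
★ `torusEntry` currency) and the `ω_v`-LEVEL SOCKET **`thetaType_nonsplit_jacquetModule_b_of_kerWeight`** («`ω_v(ch t) f − c•f ∈ Coinvariants.ker ((ω_v ∘ ch)|_N)`»,
`ch = localLineInl ∘ localPiEquiv⁻¹ ∘ congr_T` as in ★ p832817); the packager `thetaType_nonsplit_jacquetModule_of_a_of_torusWeight (hA) (hD) :` the letter is the sequel file
`Theorems/F0P2oN3OfTorusWeight.lean` (so that the N3 `_holds` fold is one token once clause (a) and the `m(γ)`-weight land).

## References
* [GelbartRogawski1991] S. Gelbart, J. Rogawski, Invent. Math. 105 (1991): §3.2 (3.2.1)–(3.2.3) p. 457; §5.1 (5.1.1) p. 465; §5.2 p. 467.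
* [Kudla1986] S. Kudla, Invent. Math. 83 (1986): Thm. 2.8.  [BernsteinZelevinsky1977] Ann. sci. ÉNS 10 (1977): §1.8.
* [Rogawski1990] J. Rogawski, Ann. of Math. Stud. 123 (1990): §1.10 p. 9; §12.1 pp. 171–172; §12.2 (2) p. 174; §3.13.
* [Liu2021] Y. Liu, Camb. J. Math. 9 (2021) = arXiv:2102.11518: Def. 4.11; App. D §D.1 Step 3.  [Mok2014] §1 Notation p. 5.  [PlatonovRapinchuk1994] §2.3.
-/

set_option autoImplicit false
-- the mandated namespace has the single-problem summit's repeated segment (`HodgeConjecture.HodgeConjecture`)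
set_option linter.dupNamespace false

noncomputable section

open NumberField IsDedekindDomain MeasureTheory
open scoped Matrix

open Literature.NumberTheory Literature.NumberTheory.Automorphic Literature.NumberTheory.Automorphic.UnitaryGroup
open Literature.NumberTheory.Automorphic.IdeleClassGroup
open Literature.NumberTheory.Automorphic.Liu2021 Literature.NumberTheory.Automorphic.Liu2021.Def411WeilCarriers
open Literature.NumberTheory.Automorphic.Liu2021.Def411WeilCarriersDoubling
open Literature.NumberTheory.GelbartRogawski1991.UnitaryDualPair Literature.NumberTheory.GelbartRogawski1991.UnitaryDualPair.WeilCoinv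
open Literature.RepresentationTheory.Liu2021
open Literature.NumberTheory.GaloisRepresentations
open Literature.NumberTheory.Rogawski1990
open Literature.NumberTheory.GelbartRogawski1991
open Literature.RepresentationTheory

namespace Summit.HodgeConjecture.HodgeConjecture.Cruxes.H413.F0P2oN3TorusWeightOfD3d


/-! ## §1 Generic: a scalar modulo the `N`-kernel descends to the Jacquet module -/

section Generic

variable {k G V W : Type*} [CommRing k] [Group G] [AddCommGroup V] [Module k V] [AddCommGroup W] [Module k W]

/-- **Coinvariant kernels along an equivariant map**: `F (ρ g v) = τ g (F v)` ⇒ `F (span {ρ g v − v}) ⊆ span {τ g w − w}`. [cite: BernsteinZelevinsky1977, §1.8] -/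
theorem coinvariantsKer_le_comap_of_comm (ρ : Representation k G V) (τ : Representation k G W) (F : V →ₗ[k] W)
    (hF : ∀ (g : G) (v : V), F (ρ g v) = τ g (F v)) :
    Representation.Coinvariants.ker ρ ≤ (Representation.Coinvariants.ker τ).comap F := by
  refine Submodule.span_le.2 ?_
  rintro _ ⟨⟨g, v⟩, rfl⟩
  rw [SetLike.mem_coe, Submodule.mem_comap, map_sub, hF]
  exact Representation.Coinvariants.sub_mem_ker g (F v)

/-- **The two spellings of `ρ|_N` have the same relation submodule**: `Coinvariants.ker (t.restrict ρ)` (`N` inside `P`, the carrier of ★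
`Representation.jacquetModule`) `= Coinvariants.ker (ρ ∘ N.subtype)` (`N ≤ G`, the currency of the `N`-coinvariant closers). [cite: BernsteinZelevinsky1977, §1.8] -/
theorem coinvariantsKer_restrict_eq (ρ : Representation k G V) (t : ParabolicTriple G) :
    Representation.Coinvariants.ker (t.restrict ρ) = Representation.Coinvariants.ker (ρ.comp t.N.subtype) := by
  apply le_antisymm
  · refine Submodule.span_le.2 ?_
    rintro _ ⟨⟨n, v⟩, rfl⟩
    exact Representation.Coinvariants.mem_ker_of_eq (ρ := ρ.comp t.N.subtype)
      ⟨((n : t.P) : G), Subgroup.mem_subgroupOf.1 n.2⟩ v _ rfl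
  · refine Submodule.span_le.2 ?_
    rintro _ ⟨⟨n, v⟩, rfl⟩
    exact Representation.Coinvariants.mem_ker_of_eq (ρ := t.restrict ρ)
      ⟨⟨(n : G), t.N_le n.2⟩, Subgroup.mem_subgroupOf.2 n.2⟩ v _ rfl

/-- **A scalar modulo the `N`-relations is a scalar on the Jacquet module**: if `ρ(m) v − c·v ∈ span {ρ(n) u − u}` for every `v` (`m ∈ M`), then `m`
acts on the (unnormalised) `r_N(ρ)` by `c` (★ `Representation.jacquetModule_mk`: `m • [v] = [ρ m v]`). [cite: BernsteinZelevinsky1977, §1.8] -/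
theorem jacquetModule_eq_smul_of_forall_sub_smul_mem (ρ : Representation k G V) (t : ParabolicTriple G) (m : t.M) (c : k)
    (h : ∀ v : V, ρ m v - c • v ∈ Representation.Coinvariants.ker (t.restrict ρ)) (x : (t.restrict ρ).Coinvariants) :
    ρ.jacquetModule t m x = c • x := by
  obtain ⟨v, rfl⟩ := Representation.Coinvariants.mk_surjective (t.restrict ρ) x
  rw [Representation.jacquetModule_mk, ← map_smul, Representation.Coinvariants.mk_eq_iff]
  exact h v

/-- **A central operator acts on the Jacquet module by its scalar**: if `ρ(m) = c · 1`, then `m • x = c • x` on `r_N(ρ)`. [cite: BernsteinZelevinsky1977, §1.8] -/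
theorem jacquetModule_eq_smul_of_eq_smul_one (ρ : Representation k G V) (t : ParabolicTriple G) (m : t.M) (c : k)
    (h : ρ m = c • (1 : Module.End k V)) (x : (t.restrict ρ).Coinvariants) :
    ρ.jacquetModule t m x = c • x :=
  jacquetModule_eq_smul_of_forall_sub_smul_mem ρ t m c
    (fun v => by rw [h, LinearMap.smul_apply, Module.End.one_apply, sub_self]; exact Submodule.zero_mem _) x

/-- **Descent through twisted coinvariants.**  For commuting representations `ρV` of `G` and `ρW` of `H` on `S`, a character `χ` of `H`, `φ : G′ →* G` and a
parabolic triple of `G′`: if `ρV(φ m) f − c·f` lies in the `N`-relation submodule of `ρV ∘ φ` for every `f`, then `m` acts on `r_N((ρV)_{H,χ} ∘ φ)` by `c`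
(★ `TwistedCoinv.rep`; the quotient map is equivariant and onto). [cite: BernsteinZelevinsky1977, §1.8] [cite: Liu2021, App. D §D.1 Step 3 (l. 5219)] -/
theorem jacquetModule_twistedCoinv_comp_eq_smul {G' H S : Type*} [Group G'] [Group H] [AddCommGroup S] [Module k S]
    {ρW : Representation k H S} (χ : H →* kˣ) (ρV : Representation k G S) (hc : ∀ (g : G) (h : H), Commute (ρV g) (ρW h))
    (φ : G' →* G) (t : ParabolicTriple G') (m : t.M) (c : k)
    (h : ∀ f : S, ρV (φ m) f - c • f ∈ Representation.Coinvariants.ker ((ρV.comp φ).comp t.N.subtype))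
    (x : (t.restrict ((TwistedCoinv.rep χ ρV hc).comp φ)).Coinvariants) :
    Representation.jacquetModule ((TwistedCoinv.rep χ ρV hc).comp φ) t m x = c • x := by
  refine jacquetModule_eq_smul_of_forall_sub_smul_mem _ t m c (fun y => ?_) x
  rw [coinvariantsKer_restrict_eq]
  obtain ⟨f, rfl⟩ := TwistedCoinv.mk_surjective ρW χ y
  have hle := coinvariantsKer_le_comap_of_comm ((ρV.comp φ).comp t.N.subtype) (((TwistedCoinv.rep χ ρV hc).comp φ).comp t.N.subtype)
    (TwistedCoinv.mk ρW χ) (fun n f => rfl) (h f)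
  rw [Submodule.mem_comap, map_sub, map_smul] at hle
  exact hle

end Generic

/-! ## §2 The scalar `d₁ · 1₃` of `U(Φ₃)(L⁺_v)` and the centre of `U(diag dV)(L⁺_v)` -/

section Centre

variable (L : Type) [Field L] [NumberField L] [IsCMField L]

/-- **A norm-one unit `β` of `∏_{w∣v} L_w` as an element of `U((ε))(L⁺_v) = E¹_v`** (the `1 × 1` unitary matrix `(β)`: `β̄·ε·β = ε`). [cite: Mok2014, §1 Notation p. 5] -/
theorem glDiagonal_one_mem_local (v : HeightOneSpectrum (𝓞 ↥(maximalRealSubfield L))) (ε : (↥(maximalRealSubfield L))ˣ)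
    (β : (LocalRing L v)ˣ) (hβ : conjLocal L (IsCMField.complexConj L) v (β : LocalRing L v) * β = 1) :
    glDiagonal 1 (LocalRing L v) (fun _ => β) ∈ «local» L (IsCMField.complexConj L) 1 (JW (↥(maximalRealSubfield L)) L ε) v := by
  have hg : glDiagonal 1 (LocalRing L v) (fun _ => β) = Units.map (Matrix.scalar (Fin 1) : LocalRing L v →+* _).toMonoidHom β :=
    Units.ext (by rw [coe_glDiagonal]; rfl)
  rw [hg]
  exact scalar_mem_unitaryGroupOfForm _ _ β hβ

/-- Its determinant read in `E¹_v` (★ `localDet`) is `β`. [cite: Rogawski1990, §3.13] -/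
theorem localDet_glDiagonal_one (v : HeightOneSpectrum (𝓞 ↥(maximalRealSubfield L))) (ε : (↥(maximalRealSubfield L))ˣ)
    (β : (LocalRing L v)ˣ) (hβ : conjLocal L (IsCMField.complexConj L) v (β : LocalRing L v) * β = 1) :
    ((localDet (IsCMField.complexConj L) v
        (isUnit_iff_ne_zero.mpr (by rw [Matrix.det_fin_one]; exact JW_apply_ne_zero (↥(maximalRealSubfield L)) L ε))
        ⟨glDiagonal 1 (LocalRing L v) (fun _ => β), glDiagonal_one_mem_local L v ε β hβ⟩ :
          ↥(normOneUnits (conjLocal L (IsCMField.complexConj L) v))) : (LocalRing L v)ˣ) = β := by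
  rw [coe_localDet]
  refine Units.ext ?_
  rw [Matrix.GeneralLinearGroup.val_det_apply]
  simp only [coe_glDiagonal, Matrix.det_diagonal, Fin.prod_univ_one]

set_option synthInstance.maxHeartbeats 400000 in
set_option maxHeartbeats 8000000 in
/-- **The scalar `β · 1₃ ∈ T(L⁺_v) ≤ U(Φ₃)(L⁺_v)` is carried by the form congruence `u ↦ T u T⁻¹` and `localPiEquiv⁻¹` to the CENTRAL element
`localCenter (β)` of `U(diag dV)(L⁺_v)`** (`T (β·1) T⁻¹ = β·1`; ★ `coe_cmDatumLocalCongr_apply`, ★ `coe_localCenter`). [cite: Mok2014, §1 Notation p. 5]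
[cite: PlatonovRapinchuk1994, §2.3] -/
theorem localPiEquiv_symm_cmDatumLocalCongr_scalar (v : HeightOneSpectrum (𝓞 ↥(maximalRealSubfield L))) (dV : Fin 3 → L)
    (ε : (↥(maximalRealSubfield L))ˣ)
    (T : GL (Fin 3) (LocalRing L v)) {a : LocalRing L v} (ha : IsUnit a)
    (h : formCongr (conjLocal L (IsCMField.complexConj L) v) T ((Matrix.diagonal dV).map (algebraMap L (LocalRing L v))) =
      a • (Matrix.of fun i j : Fin 3 => if i.val + j.val + 1 = 3 then (1 : L) else 0).map (algebraMap L (LocalRing L v)))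
    (z : Gqs L v) (β : (LocalRing L v)ˣ) (hβ : conjLocal L (IsCMField.complexConj L) v (β : LocalRing L v) * β = 1)
    (hz : glDiagonal 3 (LocalRing L v) (fun _ => β) = (z.val : GL (Fin 3) (LocalRing L v))) :
    (localPiEquiv L (IsCMField.complexConj L) 3 (Matrix.diagonal dV) v).symm (cmDatumLocalCongr L v T ha h z) =
      localCenter L (IsCMField.complexConj L) 3 (Matrix.diagonal dV) (JW (↥(maximalRealSubfield L)) L ε)
        (JW_apply_ne_zero (↥(maximalRealSubfield L)) L ε) v
        ((localPiEquiv L (IsCMField.complexConj L) 1 (JW (↥(maximalRealSubfield L)) L ε) v).symm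
          ⟨glDiagonal 1 (LocalRing L v) (fun _ => β), glDiagonal_one_mem_local L v ε β hβ⟩) := by
  refine Subtype.ext (funext fun w => Units.ext ?_)
  rw [coe_localPiEquiv_symm_apply, coe_localCenter, coe_localPiEquiv_symm_apply, coe_localScalarGL_apply,
    GLn.coe_piEquiv_apply, GLn.coe_piEquiv_apply]
  change (((cmDatumLocalCongr L v T ha h z).val : GL (Fin 3) (LocalRing L v)) : Matrix (Fin 3) (Fin 3) (LocalRing L v)).map _ = _
  rw [coe_cmDatumLocalCongr_apply, Units.val_mul, Units.val_mul, ← hz, coe_glDiagonal]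
  change _ = ((((glDiagonal 1 (LocalRing L v) (fun _ => β) : GL (Fin 1) (LocalRing L v)) : Matrix (Fin 1) (Fin 1) (LocalRing L v)).map _) 0 0) • _
  rw [coe_glDiagonal, ← Matrix.smul_one_eq_diagonal, ← Matrix.smul_one_eq_diagonal, Matrix.mul_smul, Matrix.mul_one, Matrix.smul_mul,
    Units.mul_inv, map_smul_one, map_smul_one, Matrix.smul_apply, Matrix.one_apply_eq, smul_eq_mul, mul_one]

/-- **`‖β‖^{1/2} = 1` on `E¹_v`**: a `σ`-norm-one unit has trivial modulus (`‖σβ‖ = ‖β‖` ★ `unitModulusChar_units_map_of_involutive`, `σβ·β = 1`). [cite: Rogawski1990, §12.2 p. 173] -/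
theorem halfModulusChar_eq_one_of_norm_one (v : HeightOneSpectrum (𝓞 ↥(maximalRealSubfield L)))
    (β : (LocalRing L v)ˣ) (hβ : conjLocal L (IsCMField.complexConj L) v (β : LocalRing L v) * β = 1) :
    halfModulusChar (LocalRing L v) β = 1 := by
  have hmap : Units.map (conjLocal L (IsCMField.complexConj L) v : LocalRing L v →* LocalRing L v) β = β⁻¹ :=
    eq_inv_of_mul_eq_one_left (Units.ext (by rw [Units.val_mul, Units.coe_map, MonoidHom.coe_coe, Units.val_one]; exact hβ))
  have hu : unitModulusChar (LocalRing L v) β ^ 2 = 1 := by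
    rw [sq]
    nth_rw 1 [← F0P2oK1wOfWeylConj.unitModulusChar_units_map_of_involutive (conjLocal L (IsCMField.complexConj L) v)
      (continuous_conjLocal L (IsCMField.complexConj L) v) (conjLocal_conjLocal_cm L v) β]
    rw [hmap, ← map_mul, inv_mul_cancel, map_one]
  have hu1 : unitModulusChar (LocalRing L v) β = 1 := (pow_eq_one_iff_of_nonneg (by positivity) two_ne_zero).1 hu
  refine Units.ext ?_
  rw [coe_halfModulusChar_apply, hu1, NNReal.sqrt_one, NNReal.coe_one, Complex.ofReal_one, Units.val_one]

end Centre

/-! ## §3 Clause (b) of N3 from the `m(γ)`-weight -/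

/-- Commutative-group bookkeeping for the torus weight: `A⁻¹·B·C·(C⁻¹·D·E) = A⁻¹·D·E·B`. [folklore] -/
theorem commGroup_aux {M : Type*} [CommGroup M] (A B C D E : M) : A⁻¹ * B * C * (C⁻¹ * D * E) = A⁻¹ * D * E * B := by
  rw [mul_assoc C⁻¹, mul_assoc (A⁻¹ * B), mul_inv_cancel_left, mul_right_comm, ← mul_assoc]

section ClauseB

variable (L : Type) [Field L] [NumberField L] [IsCMField L]

set_option synthInstance.maxHeartbeats 400000 in
set_option maxHeartbeats 16000000 in
/-- **The centre acts on `r_N(X_v)` by `χ_{f,v}`** — K0 ★ `xThetaCM_localCenter` read on `U(Φ₃)(L⁺_v)` along the form congruence and pushed to the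
Jacquet module: for `z = β·1₃ ∈ T(L⁺_v)` (`β ∈ E¹_v`), `z • x = χ_{f,v}(β) • x` on `r_N(X_v)`. [cite: Liu2021, Def. 4.11 (l. 2090–2096)]
[cite: GelbartRogawski1991, §3.2 (3.2.1) p. 457] -/
theorem jacquetModule_xThetaGqsCM_scalar {n' : ℕ} (e₁ : Fin 3 × Fin 1 ≃ Fin n') (dV : Fin 3 → L)
    (hdV : ∀ i, IsCMField.complexConj L (dV i) = dV i) (hdV0 : ∀ i, dV i ≠ 0)
    (μ : Literature.NumberTheory.Automorphic.IdeleClassGroup L →ₜ* Circle) (hμ : IsConjugateSymplectic L μ)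
    (χf : UnitaryGroup.finAdelicOne (↥(maximalRealSubfield L)) L (IsCMField.complexConj L) →* ℂˣ) (ε : (↥(maximalRealSubfield L))ˣ)
    (v : HeightOneSpectrum (𝓞 ↥(maximalRealSubfield L)))
    (T : GL (Fin 3) (UnitaryGroup.LocalRing L v)) {a : UnitaryGroup.LocalRing L v} (ha : IsUnit a)
    (h : formCongr (conjLocal L (IsCMField.complexConj L) v) T ((Matrix.diagonal dV).map (algebraMap L (UnitaryGroup.LocalRing L v))) =
      a • (Matrix.of fun i j : Fin 3 => if i.val + j.val + 1 = 3 then (1 : L) else 0).map (algebraMap L (UnitaryGroup.LocalRing L v)))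
    (z : ↥(cmBorelTriple L 3 v).M) (β : (LocalRing L v)ˣ) (hβ : conjLocal L (IsCMField.complexConj L) v (β : LocalRing L v) * β = 1)
    (hz : glDiagonal 3 (LocalRing L v) (fun _ => β) =
      ((z : ↥(unitaryGroupOfForm (conjLocal L (IsCMField.complexConj L) v) (cmLocalForm L 3 v))) : GL (Fin 3) (LocalRing L v)))
    (x : ((cmBorelTriple L 3 v).restrict (xThetaGqsCM L e₁ dV hdV hdV0 μ hμ χf ε v T ha h)).Coinvariants) :
    Representation.jacquetModule (xThetaGqsCM L e₁ dV hdV hdV0 μ hμ χf ε v T ha h) (cmBorelTriple L 3 v) z x =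
      ((localCharOfCenter (↥(maximalRealSubfield L)) L (IsCMField.complexConj L) (JW (↥(maximalRealSubfield L)) L ε)
          (JW_apply_ne_zero (↥(maximalRealSubfield L)) L ε) χf v
          ((localPiEquiv L (IsCMField.complexConj L) 1 (JW (↥(maximalRealSubfield L)) L ε) v).symm
            ⟨glDiagonal 1 (LocalRing L v) (fun _ => β), glDiagonal_one_mem_local L v ε β hβ⟩) : ℂˣ) : ℂ) • x := by
  refine jacquetModule_eq_smul_of_eq_smul_one _ (cmBorelTriple L 3 v) z _ ?_ x
  have hz' := localPiEquiv_symm_cmDatumLocalCongr_scalar L v dV ε T ha h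
    (z : ↥(unitaryGroupOfForm (conjLocal L (IsCMField.complexConj L) v) (cmLocalForm L 3 v))) β hβ hz
  have key : xThetaGqsCM L e₁ dV hdV hdV0 μ hμ χf ε v T ha h
        (z : ↥(unitaryGroupOfForm (conjLocal L (IsCMField.complexConj L) v) (cmLocalForm L 3 v))) =
      xThetaCM L e₁ dV hdV hdV0 μ hμ χf ε v
        (localCenter L (IsCMField.complexConj L) 3 (Matrix.diagonal dV) (JW (↥(maximalRealSubfield L)) L ε)
          (JW_apply_ne_zero (↥(maximalRealSubfield L)) L ε) v
          ((localPiEquiv L (IsCMField.complexConj L) 1 (JW (↥(maximalRealSubfield L)) L ε) v).symm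
            ⟨glDiagonal 1 (LocalRing L v) (fun _ => β), glDiagonal_one_mem_local L v ε β hβ⟩)) :=
    congrArg (xThetaCM L e₁ dV hdV hdV0 μ hμ χf ε v : localPi L (IsCMField.complexConj L) 3 (Matrix.diagonal dV) v →* _) hz'
  exact key.trans (F0P2nXThetaCentralCharacter.xThetaCM_localCenter L e₁ dV hdV hdV0 μ hμ χf ε v _)

set_option synthInstance.maxHeartbeats 400000 in
set_option maxHeartbeats 16000000 in
/-- **N3 CLAUSE (b) FROM THE `m(γ)`-WEIGHT.**  Hypothesis `hD` («(D3d) on the Jacquet module»): every `t ∈ T(L⁺_v)` with `t₁₁ = 1` (i.e. `t = m(γ) = d(γ, 1, γ̄⁻¹)`,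
`γ = t₀₀`) acts on the UNNORMALISED Jacquet module `r_N(X_v)` (★ `xThetaGqsCM`) by `μ_v(γ)·‖γ‖^{1/2}`.  Conclusion: clause (b) of ★ `thetaType_nonsplit_jacquetModule`
VERBATIM for every `ψθ` with ★ `IsThetaCenterChar` — `d(α, β, ᾱ⁻¹) = z(β)·m(α/β)`, `z(β)` central acting by `χ_{f,v}(β)` (★ K0 `xThetaCM_localCenter`), `‖β‖ = 1`,
`χ_{f,v}(β)μ_v(β)⁻¹ = ψθ(β)`, ★ `xiTorusChar_apply`; NO (S5) dictionary. [cite: GelbartRogawski1991, §3.2 (3.2.1)–(3.2.2) p. 457]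
[cite: Rogawski1990, §1.10 p. 9; §12.2 (2) p. 174] [cite: Kudla1986, Thm. 2.8] -/
theorem thetaType_nonsplit_jacquetModule_b_of_torusWeight {n' : ℕ} (e₁ : Fin 3 × Fin 1 ≃ Fin n') (dV : Fin 3 → L)
    (hdV : ∀ i, IsCMField.complexConj L (dV i) = dV i) (hdV0 : ∀ i, dV i ≠ 0)
    (μ : Literature.NumberTheory.Automorphic.IdeleClassGroup L →ₜ* Circle) (hμ : IsConjugateSymplectic L μ)
    (χf : UnitaryGroup.finAdelicOne (↥(maximalRealSubfield L)) L (IsCMField.complexConj L) →* ℂˣ)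
    (v : HeightOneSpectrum (𝓞 ↥(maximalRealSubfield L)))
    (ε : (↥(maximalRealSubfield L))ˣ) (ψθ : ↥(normOneUnits (conjLocal L (IsCMField.complexConj L) v)) →* ℂˣ)
    (hθ : IsThetaCenterChar L μ χf ε v ψθ)
    (T : GL (Fin 3) (UnitaryGroup.LocalRing L v)) {a : UnitaryGroup.LocalRing L v} (ha : IsUnit a)
    (h : formCongr (conjLocal L (IsCMField.complexConj L) v) T ((Matrix.diagonal dV).map (algebraMap L (UnitaryGroup.LocalRing L v))) =
      a • (Matrix.of fun i j : Fin 3 => if i.val + j.val + 1 = 3 then (1 : L) else 0).map (algebraMap L (UnitaryGroup.LocalRing L v)))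
    (hD : ∀ (t : ↥(cmBorelTriple L 3 v).M),
      torusEntry (conjLocal L (IsCMField.complexConj L) v) (cmLocalForm L 3 v) 1 t = 1 →
      ∀ x : ((cmBorelTriple L 3 v).restrict (xThetaGqsCM L e₁ dV hdV hdV0 μ hμ χf ε v T ha h)).Coinvariants,
        Representation.jacquetModule (xThetaGqsCM L e₁ dV hdV hdV0 μ hμ χf ε v T ha h) (cmBorelTriple L 3 v) t x =
          (((toHeckeCharacter L μ).semilocalComponent L v (torusEntry (conjLocal L (IsCMField.complexConj L) v) (cmLocalForm L 3 v) 0 t) *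
              halfModulusChar (UnitaryGroup.LocalRing L v) (torusEntry (conjLocal L (IsCMField.complexConj L) v) (cmLocalForm L 3 v) 0 t) : ℂˣ) : ℂ) • x)
    (t : ↥(cmBorelTriple L 3 v).M) (x : ((cmBorelTriple L 3 v).restrict (xThetaGqsCM L e₁ dV hdV hdV0 μ hμ χf ε v T ha h)).Coinvariants) :
    Representation.jacquetModule (xThetaGqsCM L e₁ dV hdV hdV0 μ hμ χf ε v T ha h) (cmBorelTriple L 3 v) t x =
      ((cmXiTorusChar L v ((toHeckeCharacter L μ).semilocalComponent L v) ψθ⁻¹ ψθ t : ℂˣ) : ℂ) • x := by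
  -- torus coordinates `t = diag(d)` and the unitarity relations `σ(d₁) d₁ = 1`, `σ(d₀) d₂ = 1`
  obtain ⟨d, hd⟩ := (mem_torusU_iff _).1 t.2
  have hJ := cmLocalForm_eq_over L 3 v
  have hσσ := conjLocal_conjLocal_cm L v
  have hrel : ∀ i : Fin 3, conjLocal L (IsCMField.complexConj L) v (d (Fin.rev i) : LocalRing L v) * (d i : LocalRing L v) = 1 := by
    have hdU : glDiagonal 3 (LocalRing L v) d ∈ unitaryGroupOfForm (conjLocal L (IsCMField.complexConj L) v)
        ((StdForm.antidiagonal 3).over (LocalRing L v)) := by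
      rw [hd, ← hJ]; exact (t : ↥(unitaryGroupOfForm (conjLocal L (IsCMField.complexConj L) v) (cmLocalForm L 3 v))).2
    exact (glDiagonal_mem_unitaryGroupOfForm_antidiagonal_iff (conjLocal L (IsCMField.complexConj L) v) 3 d).1 hdU
  have hrev1 : Fin.rev (1 : Fin 3) = 1 := by decide
  have hrev2 : Fin.rev (2 : Fin 3) = 0 := by decide
  have h11 : conjLocal L (IsCMField.complexConj L) v (d 1 : LocalRing L v) * (d 1 : LocalRing L v) = 1 := by
    have h := hrel 1; rwa [hrev1] at h
  have h02 : conjLocal L (IsCMField.complexConj L) v (d 0 : LocalRing L v) * (d 2 : LocalRing L v) = 1 := by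
    have h := hrel 2; rwa [hrev2] at h
  -- the central factor `z = d₁ · 1₃ ∈ T(L⁺_v)`
  have hzU : glDiagonal 3 (LocalRing L v) (fun _ => d 1) ∈ unitaryGroupOfForm (conjLocal L (IsCMField.complexConj L) v) (cmLocalForm L 3 v) := by
    rw [hJ, glDiagonal_mem_unitaryGroupOfForm_antidiagonal_iff]
    exact fun _ => h11
  obtain ⟨z, hz⟩ : ∃ z : ↥(cmBorelTriple L 3 v).M, glDiagonal 3 (LocalRing L v) (fun _ => d 1) =
      ((z : ↥(unitaryGroupOfForm (conjLocal L (IsCMField.complexConj L) v) (cmLocalForm L 3 v))) : GL (Fin 3) (LocalRing L v)) :=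
    ⟨⟨⟨glDiagonal 3 (LocalRing L v) (fun _ => d 1), hzU⟩, ⟨fun _ => d 1, rfl⟩⟩, rfl⟩
  -- `m := z⁻¹ · t = d(d₀/d₁, 1, d₂/d₁)`: middle entry `1`, first entry `d₁⁻¹ d₀`
  obtain ⟨m, rfl⟩ : ∃ m : ↥(cmBorelTriple L 3 v).M, t = z * m := ⟨z⁻¹ * t, by simp⟩
  have hm1 : torusEntry (conjLocal L (IsCMField.complexConj L) v) (cmLocalForm L 3 v) 1 m = 1 := by
    have h1 := torusEntry_eq_of_glDiagonal_eq (conjLocal L (IsCMField.complexConj L) v) (cmLocalForm L 3 v) 1 (z * m) d hd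
    rw [map_mul, torusEntry_eq_of_glDiagonal_eq (conjLocal L (IsCMField.complexConj L) v) (cmLocalForm L 3 v) 1 z _ hz] at h1
    exact mul_left_cancel (h1.trans (mul_one (d 1)).symm)
  have hm0 : torusEntry (conjLocal L (IsCMField.complexConj L) v) (cmLocalForm L 3 v) 0 m = (d 1)⁻¹ * d 0 := by
    have h0 := torusEntry_eq_of_glDiagonal_eq (conjLocal L (IsCMField.complexConj L) v) (cmLocalForm L 3 v) 0 (z * m) d hd
    rw [map_mul, torusEntry_eq_of_glDiagonal_eq (conjLocal L (IsCMField.complexConj L) v) (cmLocalForm L 3 v) 0 z _ hz] at h0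
    exact eq_inv_mul_of_mul_eq h0
  -- `t • x = z • (m • x) = χ_{f,v}(d₁) · μ_v(d₀/d₁)‖d₀/d₁‖^{1/2} · x`
  refine (LinearMap.congr_fun (map_mul (Representation.jacquetModule (xThetaGqsCM L e₁ dV hdV hdV0 μ hμ χf ε v T ha h) (cmBorelTriple L 3 v)) z m) x).trans ?_
  refine (congrArg (Representation.jacquetModule (xThetaGqsCM L e₁ dV hdV hdV0 μ hμ χf ε v T ha h) (cmBorelTriple L 3 v) z) (hD m hm1 x)).trans ?_
  refine (jacquetModule_xThetaGqsCM_scalar L e₁ dV hdV hdV0 μ hμ χf ε v T ha h z (d 1) h11 hz _).trans ?_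
  refine (smul_smul _ _ x).trans ?_
  congr 1
  rw [← Units.val_mul]
  -- the scalar identity `μ_v(d₀/d₁)‖d₀/d₁‖^{1/2} · χ_{f,v}(d₁) = χθ(t)` in `ℂˣ`
  -- (1) `χ_{f,v}(d₁) = ψθ(d₁) · μ_v(d₁)` (`IsThetaCenterChar`)
  have hθu := hθ ((localPiEquiv L (IsCMField.complexConj L) 1 (JW (↥(maximalRealSubfield L)) L ε) v).symm
    ⟨glDiagonal 1 (LocalRing L v) (fun _ => d 1), glDiagonal_one_mem_local L v ε (d 1) h11⟩)
  rw [ContinuousMulEquiv.apply_symm_apply] at hθu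
  have hdet : localDet (IsCMField.complexConj L) v
      (isUnit_iff_ne_zero.mpr (by rw [Matrix.det_fin_one]; exact JW_apply_ne_zero (↥(maximalRealSubfield L)) L ε))
      ⟨glDiagonal 1 (LocalRing L v) (fun _ => d 1), glDiagonal_one_mem_local L v ε (d 1) h11⟩ =
      ⟨d 1, (mem_normOneUnits_iff _).2 h11⟩ := Subtype.ext (localDet_glDiagonal_one L v ε (d 1) h11)
  rw [hdet] at hθu
  have hχ : localCharOfCenter (↥(maximalRealSubfield L)) L (IsCMField.complexConj L) (JW (↥(maximalRealSubfield L)) L ε)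
        (JW_apply_ne_zero (↥(maximalRealSubfield L)) L ε) χf v
        ((localPiEquiv L (IsCMField.complexConj L) 1 (JW (↥(maximalRealSubfield L)) L ε) v).symm
          ⟨glDiagonal 1 (LocalRing L v) (fun _ => d 1), glDiagonal_one_mem_local L v ε (d 1) h11⟩) =
      ψθ ⟨d 1, (mem_normOneUnits_iff _).2 h11⟩ * (toHeckeCharacter L μ).semilocalComponent L v (d 1) := by
    rw [hθu, inv_mul_cancel_right]
  -- (2) `‖d₁‖^{1/2} = 1`
  have hhm : halfModulusChar (LocalRing L v) (d 1) = 1 := halfModulusChar_eq_one_of_norm_one L v (d 1) h11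
  -- (3) `ψθ⁻¹(d₀/σd₀) · ψθ(det t) = ψθ(d₁)` (`det t = d₀ d₁ d₂`, `σ(d₀) d₂ = 1`)
  have hσd0 : Units.map (conjLocal L (IsCMField.complexConj L) v : LocalRing L v →* LocalRing L v) (d 0) = (d 2)⁻¹ :=
    eq_inv_of_mul_eq_one_left (Units.ext (by rw [Units.val_mul, Units.coe_map, MonoidHom.coe_coe, Units.val_one]; exact h02))
  have hψ : (ψθ (quotConj (conjLocal L (IsCMField.complexConj L) v) hσσ (d 0)))⁻¹ *
      ψθ (torusDetNormOne (conjLocal L (IsCMField.complexConj L) v) (cmLocalForm L 3 v) hJ (z * m)) = ψθ ⟨d 1, (mem_normOneUnits_iff _).2 h11⟩ := by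
    rw [← map_inv, ← map_mul]
    congr 1
    refine Subtype.ext ?_
    change _ = d 1
    rw [Subgroup.coe_mul, Subgroup.coe_inv, coe_quotConj, coe_torusDetNormOne,
      torusDet_eq_of_glDiagonal_eq (conjLocal L (IsCMField.complexConj L) v) (cmLocalForm L 3 v) (z * m) d hd,
      Fin.prod_univ_three, hσd0, inv_inv, mul_right_comm (d 0) (d 1) (d 2), inv_mul_cancel_left]
  -- assemble (in `ℂˣ`)
  congr 1
  rw [hm0, cmXiTorusChar, xiTorusChar_apply, torusEntry_eq_of_glDiagonal_eq _ _ 0 (z * m) d hd, hχ, map_mul, map_mul, map_inv, map_inv, hhm,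
    inv_one, one_mul, MonoidHom.inv_apply, ← hψ]
  exact commGroup_aux _ _ _ _ _

set_option synthInstance.maxHeartbeats 400000 in
set_option maxHeartbeats 16000000 in
/-- **N3 CLAUSE (b) FROM THE `m(γ)`-WEIGHT AT THE `ω_v`-LEVEL** (the (D3d) output currency fixed by the K1 lead, 2026-08-31T20:54:00Z): if for every
`t ∈ T(L⁺_v)` with `t₁₁ = 1` and every `f ∈ 𝒮(L⁺_v^{n′})`, `ω_v(ch t) f − μ_v(t₀₀)‖t₀₀‖^{1/2} · f` lies in the `N`-relation submodule
`Coinvariants.ker ((ω_v ∘ ch)|_N)` of the local Weil representation `ω_v = (chiLocalSplittingsCM … (toHeckeCharacter μ) _ ε).omegaLoc v` pulled back along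
`ch = localLineInl ∘ localPiEquiv⁻¹ ∘ congr_T` (★ p832817's reading), then clause (b) of ★ `thetaType_nonsplit_jacquetModule` holds for every `ψθ` with
`IsThetaCenterChar` — §1 `jacquetModule_twistedCoinv_comp_eq_smul` (`X_v = (ω_v)_{U(W), χ_{f,v}} ∘ localLineInl`, ★ `xThetaCM`, definitionally) followed by
`thetaType_nonsplit_jacquetModule_b_of_torusWeight`. [cite: GelbartRogawski1991, §3.2 (3.2.1)–(3.2.2) p. 457] [cite: Kudla1986, Thm. 2.8]
[cite: Liu2021, Def. 4.11 (l. 2090–2096)] -/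
theorem thetaType_nonsplit_jacquetModule_b_of_kerWeight {n' : ℕ} (e₁ : Fin 3 × Fin 1 ≃ Fin n') (dV : Fin 3 → L)
    (hdV : ∀ i, IsCMField.complexConj L (dV i) = dV i) (hdV0 : ∀ i, dV i ≠ 0)
    (μ : Literature.NumberTheory.Automorphic.IdeleClassGroup L →ₜ* Circle) (hμ : IsConjugateSymplectic L μ)
    (χf : UnitaryGroup.finAdelicOne (↥(maximalRealSubfield L)) L (IsCMField.complexConj L) →* ℂˣ)
    (v : HeightOneSpectrum (𝓞 ↥(maximalRealSubfield L)))
    (ε : (↥(maximalRealSubfield L))ˣ) (ψθ : ↥(normOneUnits (conjLocal L (IsCMField.complexConj L) v)) →* ℂˣ)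
    (hθ : IsThetaCenterChar L μ χf ε v ψθ)
    (T : GL (Fin 3) (UnitaryGroup.LocalRing L v)) {a : UnitaryGroup.LocalRing L v} (ha : IsUnit a)
    (h : formCongr (conjLocal L (IsCMField.complexConj L) v) T ((Matrix.diagonal dV).map (algebraMap L (UnitaryGroup.LocalRing L v))) =
      a • (Matrix.of fun i j : Fin 3 => if i.val + j.val + 1 = 3 then (1 : L) else 0).map (algebraMap L (UnitaryGroup.LocalRing L v)))
    (hK : ∀ (t : ↥(cmBorelTriple L 3 v).M),
      torusEntry (conjLocal L (IsCMField.complexConj L) v) (cmLocalForm L 3 v) 1 t = 1 →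
      ∀ f : SchwartzBruhat (Fin n' → v.adicCompletion ↥(maximalRealSubfield L)),
        (chiLocalSplittingsCM L e₁ dV hdV hdV0 (toHeckeCharacter L μ) ((isOscillatorChar_toHeckeCharacter_iff μ).mpr hμ) ε).omegaLoc v
            (((localLineInl L (IsCMField.complexConj L) 3 e₁ (Matrix.diagonal dV) (JW (↥(maximalRealSubfield L)) L ε) v).comp
              ((localPiEquiv L (IsCMField.complexConj L) 3 (Matrix.diagonal dV) v).symm.toMonoidHom.comp
                (cmDatumLocalCongr L v T ha h).toMonoidHom)) (t : ↥(unitaryGroupOfForm (conjLocal L (IsCMField.complexConj L) v) (cmLocalForm L 3 v)))) f -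
          (((toHeckeCharacter L μ).semilocalComponent L v (torusEntry (conjLocal L (IsCMField.complexConj L) v) (cmLocalForm L 3 v) 0 t) *
              halfModulusChar (UnitaryGroup.LocalRing L v) (torusEntry (conjLocal L (IsCMField.complexConj L) v) (cmLocalForm L 3 v) 0 t) : ℂˣ) : ℂ) • f ∈
        Representation.Coinvariants.ker
          ((((chiLocalSplittingsCM L e₁ dV hdV hdV0 (toHeckeCharacter L μ) ((isOscillatorChar_toHeckeCharacter_iff μ).mpr hμ) ε).omegaLoc v).comp
            ((localLineInl L (IsCMField.complexConj L) 3 e₁ (Matrix.diagonal dV) (JW (↥(maximalRealSubfield L)) L ε) v).comp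
              ((localPiEquiv L (IsCMField.complexConj L) 3 (Matrix.diagonal dV) v).symm.toMonoidHom.comp
                (cmDatumLocalCongr L v T ha h).toMonoidHom))).comp (cmBorelTriple L 3 v).N.subtype))
    (t : ↥(cmBorelTriple L 3 v).M) (x : ((cmBorelTriple L 3 v).restrict (xThetaGqsCM L e₁ dV hdV hdV0 μ hμ χf ε v T ha h)).Coinvariants) :
    Representation.jacquetModule (xThetaGqsCM L e₁ dV hdV hdV0 μ hμ χf ε v T ha h) (cmBorelTriple L 3 v) t x =
      ((cmXiTorusChar L v ((toHeckeCharacter L μ).semilocalComponent L v) ψθ⁻¹ ψθ t : ℂˣ) : ℂ) • x :=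
  thetaType_nonsplit_jacquetModule_b_of_torusWeight L e₁ dV hdV hdV0 μ hμ χf v ε ψθ hθ T ha h
    (fun t' ht' x' => jacquetModule_twistedCoinv_comp_eq_smul
      (localCharOfCenter (↥(maximalRealSubfield L)) L (IsCMField.complexConj L) (JW (↥(maximalRealSubfield L)) L ε)
        (JW_apply_ne_zero (↥(maximalRealSubfield L)) L ε) χf v)
      ((chiLocalSplittingsCM L e₁ dV hdV hdV0 (toHeckeCharacter L μ) ((isOscillatorChar_toHeckeCharacter_iff μ).mpr hμ) ε).omegaLoc v)
      (commute_omegaLoc_localCenter (↥(maximalRealSubfield L)) L (IsCMField.complexConj L) 3 e₁ (Matrix.diagonal dV)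
        (JW (↥(maximalRealSubfield L)) L ε) (complexConj_imagUnit L) (imagUnit_ne_zero L) (imagUnit_mul_self L)
        (realDiagonal_isSymm L dV hdV) (isSymm_TW (↥(maximalRealSubfield L)) ε) (realDiagonal_map L dV hdV).symm
        (JW_eq (↥(maximalRealSubfield L)) L ε) (JW_apply_ne_zero (↥(maximalRealSubfield L)) L ε)
        (chiLocalSplittingsCM L e₁ dV hdV hdV0 (toHeckeCharacter L μ) ((isOscillatorChar_toHeckeCharacter_iff μ).mpr hμ) ε) v)
      ((localLineInl L (IsCMField.complexConj L) 3 e₁ (Matrix.diagonal dV) (JW (↥(maximalRealSubfield L)) L ε) v).comp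
        ((localPiEquiv L (IsCMField.complexConj L) 3 (Matrix.diagonal dV) v).symm.toMonoidHom.comp (cmDatumLocalCongr L v T ha h).toMonoidHom))
      (cmBorelTriple L 3 v) t' _ (hK t' ht') x')
    t x

end ClauseB

end Summit.HodgeConjecture.HodgeConjecture.Cruxes.H413.F0P2oN3TorusWeightOfD3d

end
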